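import Summits.BirchSwinnertonDyer.Rank1Residual.AdditivePotMult.PotMultKatoFirstUnitIndex
import Summits.BirchSwinnertonDyer.Rank1Residual.Additive.ChiBranchLowerAscent
import Summits.BirchSwinnertonDyer.Rank1Residual.Additive.ChiBranchRatLowerDvdMult
import HarnessLib

/-!
# X4(M) ∩ {`ρ̄_{E,p}` onto}, EVERY odd `p` (`p = 3` included): the census record at index `b` + the
# budget `b ≤ λ(X(E/ℚ_∞))` (partner-free, or from a CONGRUENT PARTNER) ⟹ the team's typed (M) LOWER
# nodes HOLD at the pair — n1011-p10's `QuadraticBranchLowerDivisibilityAt E♭ p` (integral, every twist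
# model) and n1011-p06's `ChiBranchRatCharEqMult[Odd]At E p` (whence `BSD(E,p)` in analytic rank `0`,
# sequel) (cell `b2b-bsdres`, team n1011, seat p07 (gen 3), row T-E3dM = T-E3d F3; the K-OUT of
# `PotMultKatoFirstUnitIndex.lean`, the (M) twin of n1011-p10's Route G)

HONEST FRAMING (cell `b2b-bsdres`, run/shared/lean/b2b/bsd-rank1-residual/, verbatim in every
file): the goal of the cell is to DELETE the COMBINATION-SHAPED residual classes of the
Birch–Swinnerton-Dyer formula for ALL analytic-rank `≤ 1` elliptic curves over `ℚ` — "full BSD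
formula for every rank `≤ 1` curve in class `C`" assembled STRICTLY from published theorems — so
that the rank-`≤ 1` remainder becomes exactly the CONSTRUCTION-SHAPED classes, which are TYPED
(missing-input `Prop`s), NOT attempted. This is not "finishing BSD". Team n1011 (RESIDUAL-MAP §I
N10 / N11 LOWER half on the (M) rows = X4(M) ∧ surj(p) ∧ `r_an = 0`, every odd `p`): research route
on CONSTRUCTION-SHAPED items; labels and marks UNCHANGED; nothing booked — every closure below is PER
PAIR modulo the named facts AND two per-pair inputs outside the kernel: the census record
(CERTIFICATE-EVIDENCE, two engines) and the budget (n1011-p10's typed `BudgetLeLambdaAt`, EPW 2006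
§3 per curve, or a congruent partner's data); booking = director, per pair, after countersign. NO
Literature fact minted; NO definition. Named facts as HYPOTHESES only: `hK` (Kato 2004 Thm. 17.4 (3)
half-eigenspace reading `Wuthrich2014.kato_halfEigenCharIdeal_dvd_cyclotomicPrime_of_surjective`),
`hDel`/`hDelX` (Delbourgo 1998 Prop. 4), `hPal` (Pal 2012 Thm. 3.2, even branch), `hGZK`, `hmod`,
`hmodD`. Debt 0.

## What and why

`PotMultKatoFirstUnitIndex.lean` §1 proved, for every semistable twist datum of `E = W` and every
cyclotomic dual datum `D` of `Sel_{p^∞}(E/ℚ_∞)`: Kato's divisibility + `‖[T^b](ϖ·B)‖_p = 1` +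
`BudgetLeLambdaAt p W b` ⟹ `char_Λ X(E/ℚ_∞) = (g)`, `ι g = C(u·ϖ)·B` (`u ∈ ℤ_p^×`). Here:

* §0 `budgetLeLambdaAt_of_congruentLambdaShift`: the CONGRUENT-PARTNER source of the budget — X1's
  typed schema `CongruentLambdaShift W W₁ p e` (per pair: EPW 2006 Thm. 3.3.3) + a partner `W₁` whose
  cyclotomic dual data are torsion with `μ = 0` and `r₁ ≤ λ` (e.g. by n1011-p10's
  `le_lambdaInvariant_of_le_mordellWeilRank` from Kato integrality at `W₁` and `r₁ ≤ rank W₁(ℚ)`)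
  ⟹ `BudgetLeLambdaAt p W b` for every `b ≤ r₁ + e`. So K-C/K-C′ FACTOR THROUGH K-F₀ and everything
  below is stated over the budget alone.
* §1 `ClassX4M.chiBranchRatCharEqMultAt_of_katoHalf_of_firstUnitIndex_of_budget` (`p ≡ 1 (mod 4)`)
  / `…MultOddAt…_odd` (`p ≡ 3 (mod 4)`): n1011-p06's RATIONAL (M) node holds at the pair, with
  exponent `k = 0` (the unit `u` is absorbed into the generator).
* §2 `ClassX4M.forall_quadraticBranchLowerDivisibilityAt_of_katoHalf_of_firstUnitIndex_of_budget[_odd]`: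
  n1011-p10's INTEGRAL `E♭`-level node holds at the pair for EVERY twist model `V` of `E` — by seat
  p07 gen 2's eigen-ASCENT of dual data (`ChiEigenSelmerInDualData.toSelmerDualData`: an eigen datum
  of `e_{(p−1)/2} Sel_{p^∞}(E♭/ℚ(μ_{p^∞}))` IS a cyclotomic dual datum of `Sel_{p^∞}(E/ℚ_∞)`, same
  module, same `char`), the main conjecture at the ascended datum, and `V` multiplicative
  (`ClassX4M.mult_of_twist_model_pStar`, so the good-ordinary disjunct of the node is void).
* the rank-`0` ENDS (sequel `PotMultBudgetRankZeroEnds.lean`, by the existing consumers BY NAME —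
  gen 2's `X4RankZeroQuadraticBranchLower.lean` over n1011-p14's `hL20`-free upper chain): on X4(M) ∧
  surj(p) ∧ `r_an = 0`, EVERY odd `p` incl. `3`,
  **`BSD(E,p)` ⟸ {hK, hDel, hDelX, hPal, hGZK, hmod, hmodD} ∧ record(b) ∧ budget(b)**.

What is NOT claimed: the budget / partner inputs themselves (instrument tier, outside the kernel);
rows with `n₀ > B(E,p)` and no partner (pure-Ш void rows: Kolyvagin/visibility only); non-surjective
rows (O8); `r_an = 1` (T-O7KM is the certificate route there); `p = 2`. X4(M) stays
CONSTRUCTION-SHAPED; nothing booked; no number is quoted as closing anything.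

References: K. Kato, Astérisque 295 (2004) Thm. 17.4 (3) [Kato2004Asterisque]; M. Emerton,
R. Pollack, T. Weston, Invent. Math. 163 (2006) §3 [EmertonPollackWeston2006]; R. Greenberg,
V. Vatsal, Invent. Math. 142 (2000) §2, p. 4 [GreenbergVatsal2000]; D. Delbourgo, Compositio Math.
113 (1998) Prop. 4 [Delbourgo1998]; A. Pal, Thm. 3.2 [Pal2012]; C. Skinner, E. Urban, Invent. Math.
195 (2014) Thm. 3.6.4 (shape only) [SkinnerUrban2014]; B. Mazur, J. Tate, J. Teitelbaum, Invent.
Math. 84 (1986) §I.10, §I.13 [MazurTateTeitelbaum1986Invent]; R. Greenberg, LNM 1716 (1999) §5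
[GreenbergLNM1716]; L. Washington, GTM 83 §13.2 [Washington1997].
-/

set_option autoImplicit false

noncomputable section

open scoped Classical MatrixGroups ModularForm NumberField

namespace Summit.BirchSwinnertonDyer.Rank1Residual.AdditivePotMult

open CongruenceSubgroup WeierstrassCurve NumberField Literature.NumberTheory.EllipticCurves
  Literature.NumberTheory.EllipticCurves.ModularForms
  Literature.NumberTheory.EllipticCurves.Rank1Residual
  Literature.NumberTheory.EllipticCurves.Rank1Residual.Typed
  Literature.NumberTheory.EllipticCurves.GreenbergVatsal2000
  Literature.NumberTheory.GaloisRepresentations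
  Summit.BirchSwinnertonDyer.Rank1Residual.Additive
  Summit.BirchSwinnertonDyer.Rank1Residual.Additive.CensusQ6
  Summit.BirchSwinnertonDyer.Rank1Residual.X1.MuLambda
  Summit.BirchSwinnertonDyer.Rank1Residual.X11a
  Summit.BirchSwinnertonDyer.Rank1Residual.X11a.LambdaNorm
  Summit.BirchSwinnertonDyer.Rank1Residual.Iwasawa
  IsDedekindDomain

open Summit.BirchSwinnertonDyer.Rank1Residual.X1.CongruenceTransfer (TorsionIso CongruentLambdaShift)

/-! ### §0 The congruent-partner source of the budget: K-C / K-C′ factor through K-F₀ -/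

section Partner

variable {W W₁ : WeierstrassCurve ℚ} [W.IsElliptic] [W.IsGloballyMinimal] [W₁.IsElliptic]
  [W₁.IsGloballyMinimal] {p : ℕ} [hp : Fact p.Prime]

/-- **A congruent partner supplies the budget.** `E[p] ≅ E₁[p]` (`TorsionIso`), X1's typed schema
`CongruentLambdaShift W W₁ p e` (`λ(X(E)) = λ(X(E₁)) + e` whenever both duals are torsion with `μ = 0`;
per pair: EPW 2006 Thm. 3.3.3, `e = B(E,p) − B(E₁,p)`), and at the partner: every cyclotomic dual
datum torsion with `μ = 0` and `r₁ ≤ λ(X(E₁))` ⟹ n1011-p10's `BudgetLeLambdaAt p W b` for every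
`b ≤ r₁ + e` (`μ(X(E)) = 0 ⟹ b ≤ r₁ + e ≤ λ(X(E₁)) + e = λ(X(E))`; a partner datum exists at the same
`κ/γ` by `nonempty_selmerDualData_holds`). Reduction-agnostic in `W` (also serves the (G-ord) rows).
[cite: EmertonPollackWeston2006, Thm. 3.3.3 (source of the typed schema)]
[cite: GreenbergVatsal2000, §2 Prop. (2.8), Cor. (2.3) (shape of the schema)] [cite: Washington1997, §13.2] -/
theorem budgetLeLambdaAt_of_congruentLambdaShift {e : ℤ} {r₁ b : ℕ} (hiso : TorsionIso W W₁ p)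
    (hG : CongruentLambdaShift W W₁ p e)
    (h₁ : ∀ {κ : ZpExtension ℚ p} {γ : Field.absoluteGaloisGroup ℚ},
      κ.IsCyclotomic → κ.IsTopGenerator γ → IsCyclotomicVariable p γ →
      ∀ (D₁ : W₁.SelmerDualData κ γ) [Module.Finite (IwasawaAlgebra p) D₁.X],
        D₁.IsTorsion ∧ D₁.mu = 0 ∧ r₁ ≤ lambdaInvariant p D₁.X)
    (hb : (b : ℤ) ≤ r₁ + e) : BudgetLeLambdaAt p W b := by
  intro κ γ hκ hγ hγ' D _ hX hmu
  obtain ⟨D₁⟩ := W₁.nonempty_selmerDualData_holds κ γ hγ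
  haveI : Module.Finite (IwasawaAlgebra p) D₁.X := D₁.module_finite_holds hγ
  obtain ⟨hX₁, hmu₁, hr₁⟩ := h₁ hκ hγ hγ' D₁
  have hshift : (lambdaInvariant p D.X : ℤ) = (lambdaInvariant p D₁.X : ℤ) + e :=
    hG hiso κ γ hκ hγ hγ' D D₁ hX hX₁ hmu hmu₁
  have hle : (b : ℤ) ≤ lambdaInvariant p D.X := by
    rw [hshift]
    have : (r₁ : ℤ) ≤ lambdaInvariant p D₁.X := by exact_mod_cast hr₁
    omega
  exact_mod_cast hle

end Partner

/-! ### §1 K-OUT, rational node: n1011-p06's `ChiBranchRatCharEqMult[Odd]At W p` holds at the pair -/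

section RatNode

variable {W : WeierstrassCurve ℚ} [W.IsElliptic] [W.IsGloballyMinimal] {p : ℕ} [hp : Fact p.Prime]

/-- **X4(M) ∧ surj(p), `p ≡ 1 (mod 4)`: record at index `b` + budget ⟹ n1011-p06's rational even-branch
main conjecture of the multiplicative twist `ChiBranchRatCharEqMultAt W p` HOLDS** (with `k = 0`: for
every twist datum and cyclotomic dual datum, `X` torsion and `char_Λ X = (g)`, `ι g = ϖ·L_p⁺(f, a_p, ω^{(p−1)/2}, T)`).
Route: p06's packaged Kato half (`exists_mem_charIdeal_map_eq_unit_mul_plusBranchMult_of_katoHalf`), the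
unit reading (p10's K-G), p10's `budgetSqueeze`, and the unit `u` absorbed into the generator
(`Ideal.span_singleton_mul_left_unit`). Tower from surj(p) (`PotMult.towerSurj_twist_of_surj`).
[cite: Kato2004Asterisque, Thm. 17.4 (3) (p. 273)] [cite: EmertonPollackWeston2006, Cor. 3.2.5 and Thm. 3.1.1 (source of the typed input)]
[cite: BurungaleCastellaSkinner2025, Thm. 1.1.2 (a) (shape only; nothing asserted)] -/
theorem ClassX4M.chiBranchRatCharEqMultAt_of_katoHalf_of_firstUnitIndex_of_budget
    (hK : Wuthrich2014.kato_halfEigenCharIdeal_dvd_cyclotomicPrime_of_surjective)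
    (hX : ClassX4M W p) (hsurj : Surj W p) {b : ℕ} (hrec : MultFirstUnitIndexAt W p b)
    (hbud : BudgetLeLambdaAt p W b) : ChiBranchRatCharEqMultAt W p := by
  intro V _ _ κ γ N _ f hp1 hCW hV hκ hγ hcv hf ap hap D ϖ hϖ
  have hp2 : p ≠ 2 := hX.p_ne_two
  obtain ⟨C, hC⟩ := hCW
  have hC' : C • V.quadraticTwist ((-1 : ℚ) ^ (p / 2) * p) = W := by
    rw [pStar_eq_self_of_mod_four_eq_one hp1]; exact hC
  have hsurjV : ∀ n : ℕ, V.HasSurjectiveModNGaloisRep (p ^ n : ℕ) :=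
    (ClassX4M.potMult W p hX).towerSurj_twist_of_surj hp2 hsurj V C hC'
  obtain ⟨hXt, g, hg, u, hι⟩ := exists_mem_charIdeal_map_eq_unit_mul_plusBranchMult_of_katoHalf W p hK
    (ClassX4M.potMult W p hX) V hp1 ⟨C, hC⟩ hsurjV hκ hγ hcv hf hap D ϖ hϖ
  have hn := (hrec V C hV hC f hf ap hap ϖ hϖ).2
  obtain ⟨hunit, hlam⟩ := hasUnitContent_and_lam_le_of_iota_eq_of_norm_coeff_eq_one hι hn
  haveI : Module.Finite (IwasawaAlgebra p) D.X := D.module_finite_holds hγ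
  obtain ⟨fE, hchar, -⟩ := exists_charIdeal_eq_span_singleton p D
  have hdvd : fE ∣ g := Ideal.mem_span_singleton.mp (hchar ▸ hg)
  obtain ⟨hspan, -, -⟩ := budgetSqueeze p W hbud hκ hγ hcv D hXt hchar hunit hdvd hlam
  refine ⟨hXt, PowerSeries.C ((u⁻¹ : ℤ_[p]ˣ) : ℤ_[p]) * g, 0, ?_, ?_⟩
  · rw [hchar, ← hspan]
    exact (Ideal.span_singleton_mul_left_unit ((u⁻¹).isUnit.map PowerSeries.C) g).symm
  · rw [zpow_zero, one_mul, iwasawaToPowerSeries_C_mul', hι, ← mul_assoc, ← map_mul, ← mul_assoc,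
      ← PadicInt.coe_mul, Units.inv_mul, PadicInt.coe_one, one_mul]

/-- **X4(M) ∧ surj(p), `p ≡ 3 (mod 4)` (`p = 3` included): record at index `b` + budget ⟹ n1011-p06's
rational odd-branch node `ChiBranchRatCharEqMultOddAt W p` HOLDS** (`k = 0`).
[cite: Kato2004Asterisque, Thm. 17.4 (3) (p. 273)] [cite: EmertonPollackWeston2006, Cor. 3.2.5 and Thm. 3.1.1 (source of the typed input)]
[cite: BurungaleCastellaSkinner2025, Thm. 1.1.2 (a) (shape only; nothing asserted)] -/
theorem ClassX4M.chiBranchRatCharEqMultOddAt_of_katoHalf_of_firstUnitIndex_of_budget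
    (hK : Wuthrich2014.kato_halfEigenCharIdeal_dvd_cyclotomicPrime_of_surjective)
    (hX : ClassX4M W p) (hsurj : Surj W p) {b : ℕ} (hrec : MultOddFirstUnitIndexAt W p b)
    (hbud : BudgetLeLambdaAt p W b) : ChiBranchRatCharEqMultOddAt W p := by
  intro V _ _ κ γ N _ f hp3 hCW hV hκ hγ hcv hf ap hap D ϖ hϖ
  have hp2 : p ≠ 2 := hX.p_ne_two
  obtain ⟨C, hC⟩ := hCW
  have hC' : C • V.quadraticTwist ((-1 : ℚ) ^ (p / 2) * p) = W := by
    rw [pStar_eq_neg_of_mod_four_eq_three hp3]; exact hC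
  have hsurjV : ∀ n : ℕ, V.HasSurjectiveModNGaloisRep (p ^ n : ℕ) :=
    (ClassX4M.potMult W p hX).towerSurj_twist_of_surj hp2 hsurj V C hC'
  obtain ⟨hXt, g, hg, u, hι⟩ := exists_mem_charIdeal_map_eq_unit_mul_minusBranchMult_of_katoHalf W p
    hK (ClassX4M.potMult W p hX) V hp3 ⟨C, hC⟩ hsurjV hκ hγ hcv hf hap D ϖ hϖ
  have hn := (hrec V C hV hC f hf ap hap ϖ hϖ).2
  obtain ⟨hunit, hlam⟩ := hasUnitContent_and_lam_le_of_iota_eq_of_norm_coeff_eq_one hι hn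
  haveI : Module.Finite (IwasawaAlgebra p) D.X := D.module_finite_holds hγ
  obtain ⟨fE, hchar, -⟩ := exists_charIdeal_eq_span_singleton p D
  have hdvd : fE ∣ g := Ideal.mem_span_singleton.mp (hchar ▸ hg)
  obtain ⟨hspan, -, -⟩ := budgetSqueeze p W hbud hκ hγ hcv D hXt hchar hunit hdvd hlam
  refine ⟨hXt, PowerSeries.C ((u⁻¹ : ℤ_[p]ˣ) : ℤ_[p]) * g, 0, ?_, ?_⟩
  · rw [hchar, ← hspan]
    exact (Ideal.span_singleton_mul_left_unit ((u⁻¹).isUnit.map PowerSeries.C) g).symm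
  · rw [zpow_zero, one_mul, iwasawaToPowerSeries_C_mul', hι, ← mul_assoc, ← map_mul, ← mul_assoc,
      ← PadicInt.coe_mul, Units.inv_mul, PadicInt.coe_one, one_mul]

end RatNode

/-! ### §2 K-OUT, integral node: n1011-p10's `QuadraticBranchLowerDivisibilityAt E♭ p` at every twist model -/

section IntegralNode

variable {W : WeierstrassCurve ℚ} [W.IsElliptic] [W.IsGloballyMinimal] {p : ℕ} [hp : Fact p.Prime]

/-- **X4(M) ∧ surj(p), `p ≡ 1 (mod 4)`: record at index `b` + budget ⟹ n1011-p10's INTEGRAL node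
`QuadraticBranchLowerDivisibilityAt V p` for EVERY globally minimal twist model `V` (`C • V^{(p*)} = W`).**
Given the node's binders `(K, F, κ, γ, f, B, D, ϖ, g ∈ char)`: `V` is multiplicative
(`ClassX4M.mult_of_twist_model_pStar`) so `B` is the split / non-split series with `a_p = ±1` and the
record supplies `‖[T^b](ϖ·B)‖ = 1`; the eigen datum `D` ascends to a cyclotomic dual datum of
`Sel_{p^∞}(W/ℚ_∞)` at `γ` with the same `char` (gen 2's `ChiEigenSelmerInDualData.toSelmerDualData`);
the main conjecture there (`charIdeal_eq_span_of_katoHalf_of_norm_coeff_of_budget`) makes every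
`g ∈ char` an `Λ`-multiple of `u·ϖ·B`, i.e. of `ϖ·B`. [cite: Kato2004Asterisque, Thm. 17.4 (3) (p. 273)]
[cite: GreenbergLNM1716, §5 (PDF p. 143)] [cite: SkinnerUrban2014, Thm. 3.6.4 (p. 43) (shape only; nothing asserted)]
[cite: EmertonPollackWeston2006, Cor. 3.2.5 and Thm. 3.1.1 (source of the typed input)] -/
theorem ClassX4M.forall_quadraticBranchLowerDivisibilityAt_of_katoHalf_of_firstUnitIndex_of_budget
    (hK : Wuthrich2014.kato_halfEigenCharIdeal_dvd_cyclotomicPrime_of_surjective)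
    (hX : ClassX4M W p) (hsurj : Surj W p) (hp4 : p % 4 = 1) {b : ℕ}
    (hrec : MultFirstUnitIndexAt W p b) (hbud : BudgetLeLambdaAt p W b)
    (V : WeierstrassCurve ℚ) [V.IsElliptic] [V.IsGloballyMinimal]
    (hVW : ∃ C : VariableChange ℚ, C • V.quadraticTwist ((-1) ^ (p / 2) * p : ℚ) = W) :
    QuadraticBranchLowerDivisibilityAt V p := by
  intro K _ _ _ F _ _ _ _ κ γ N _ f B hp2 hK2 hθ hB hκ hγ hcv hγK hγF hf D ϖ hϖ g hg
  have heven : Even (p / 2) := ⟨p / 4, by omega⟩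
  have hpS : ((-1 : ℚ) ^ (p / 2) * p) ≠ 0 :=
    mul_ne_zero (pow_ne_zero _ (by norm_num)) (Nat.cast_ne_zero.mpr hp.out.ne_zero)
  obtain ⟨C, hC⟩ := hVW
  have hV : Mult V p := hX.mult_of_twist_model_pStar V C hC
  have hsurjV : ∀ n : ℕ, V.HasSurjectiveModNGaloisRep (p ^ n : ℕ) :=
    (ClassX4M.potMult W p hX).towerSurj_twist_of_surj hp2 hsurj V C hC
  -- the record's unit coefficient for THIS branch series (`V` multiplicative: `a_p = ±1`)
  have hn : ‖PowerSeries.coeff b (PowerSeries.C (ϖ : ℚ_[p]) * B)‖ = 1 := by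
    have hC' : C • V.quadraticTwist (p : ℚ) = W := by
      rw [← pStar_eq_self_of_mod_four_eq_one hp4]; exact hC
    have hϖ' : (ϖ : ℝ) * V.realPeriodRat = plusPeriod f := by rw [if_pos heven] at hϖ; exact hϖ
    rcases hB with ⟨hord, -⟩ | ⟨hs, hBeq⟩ | ⟨hm, hns, hBeq⟩
    · exact absurd ((isOrdinaryAt_iff V p).mp hord).1
        (fun hgood => WeierstrassCurve.HasMultiplicativeReduction.not_hasGoodReduction (R := ℤ_[p]) hV hgood)
    · obtain ⟨h1, -⟩ := hf.cuspCoeff_eq_one_and_sq_of_split hs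
      have h := (hrec V C hV hC' f hf 1 (by exact_mod_cast h1) ϖ hϖ').2
      rw [Int.cast_one] at h
      rw [hBeq, if_pos heven]; exact h
    · obtain ⟨h1, -⟩ := hf.cuspCoeff_eq_neg_one_and_dvd_of_nonsplit hm hns
      have h := (hrec V C hV hC' f hf (-1) (by exact_mod_cast h1) ϖ hϖ').2
      rw [Int.cast_neg, Int.cast_one] at h
      rw [hBeq, if_pos heven]; exact h
  -- ascend the eigen datum to a cyclotomic dual datum of `Sel_{p^∞}(W/ℚ_∞)` at `γ`
  obtain ⟨θ, hθ2⟩ := hθ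
  have hθnr : θ ∉ Set.range (algebraMap ℚ K) := not_mem_range_algebraMap_of_sq_eq_pStar hθ2
  haveI : (V.quadraticTwist ((-1 : ℚ) ^ (p / 2) * p)).IsElliptic := V.isElliptic_quadraticTwist hpS
  let D' : W.SelmerDualData κ γ :=
    ChiEigenSelmerInDualData.toSelmerDualData V K hK2 hθnr hθ2 p κ hC (galRange (K := ℚ) F)
      (isOpen_galRange F) (coprime_index_galRange_cyclotomic p F) hp2 hγK D
  obtain ⟨-, g₀, hchar, ⟨u, hι⟩, -, -, -⟩ := charIdeal_eq_span_of_katoHalf_of_norm_coeff_of_budget hK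
    hp2 hbud V C hC hsurjV hκ hγ hcv hf D' B hB ϖ hϖ hn
  -- `g ∈ char D.X = char D' = (g₀)`, `ι g₀ = C(u·ϖ)·B`
  have hg' : g ∈ D'.charIdeal := hg
  rw [hchar] at hg'
  obtain ⟨h, rfl⟩ := Ideal.mem_span_singleton'.mp hg'
  have hCu : iwasawaToPowerSeries p (PowerSeries.C (u : ℤ_[p])) =
      PowerSeries.C (((u : ℤ_[p]) : ℚ_[p])) := by
    rw [← mul_one (PowerSeries.C (u : ℤ_[p])), iwasawaToPowerSeries_C_mul', map_one, mul_one]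
  refine ⟨PowerSeries.C (u : ℤ_[p]) * h, ?_⟩
  simp only [map_mul, hι, hCu]
  ring

/-- **X4(M) ∧ surj(p), `p ≡ 3 (mod 4)` (`p = 3` included): record at index `b` + budget ⟹
`QuadraticBranchLowerDivisibilityAt V p` for EVERY globally minimal twist model `V` (`C • V^{(−p)} = W`;
minus branch, minus period).** [cite: Kato2004Asterisque, Thm. 17.4 (3) (p. 273)]
[cite: GreenbergLNM1716, §5 (PDF p. 143)] [cite: SkinnerUrban2014, Thm. 3.6.4 (p. 43) (shape only; nothing asserted)]
[cite: EmertonPollackWeston2006, Cor. 3.2.5 and Thm. 3.1.1 (source of the typed input)] -/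
theorem ClassX4M.forall_quadraticBranchLowerDivisibilityAt_of_katoHalf_of_firstUnitIndex_of_budget_odd
    (hK : Wuthrich2014.kato_halfEigenCharIdeal_dvd_cyclotomicPrime_of_surjective)
    (hX : ClassX4M W p) (hsurj : Surj W p) (hp4 : p % 4 = 3) {b : ℕ}
    (hrec : MultOddFirstUnitIndexAt W p b) (hbud : BudgetLeLambdaAt p W b)
    (V : WeierstrassCurve ℚ) [V.IsElliptic] [V.IsGloballyMinimal]
    (hVW : ∃ C : VariableChange ℚ, C • V.quadraticTwist ((-1) ^ (p / 2) * p : ℚ) = W) :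
    QuadraticBranchLowerDivisibilityAt V p := by
  intro K _ _ _ F _ _ _ _ κ γ N _ f B hp2 hK2 hθ hB hκ hγ hcv hγK hγF hf D ϖ hϖ g hg
  have hodd : ¬ Even (p / 2) := by rw [Nat.not_even_iff_odd]; exact ⟨p / 4, by omega⟩
  have hpS : ((-1 : ℚ) ^ (p / 2) * p) ≠ 0 :=
    mul_ne_zero (pow_ne_zero _ (by norm_num)) (Nat.cast_ne_zero.mpr hp.out.ne_zero)
  obtain ⟨C, hC⟩ := hVW
  have hV : Mult V p := hX.mult_of_twist_model_pStar V C hC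
  have hsurjV : ∀ n : ℕ, V.HasSurjectiveModNGaloisRep (p ^ n : ℕ) :=
    (ClassX4M.potMult W p hX).towerSurj_twist_of_surj hp2 hsurj V C hC
  have hn : ‖PowerSeries.coeff b (PowerSeries.C (ϖ : ℚ_[p]) * B)‖ = 1 := by
    have hC' : C • V.quadraticTwist (-(p : ℚ)) = W := by
      rw [← pStar_eq_neg_of_mod_four_eq_three hp4]; exact hC
    have hϖ' : (ϖ : ℝ) * V.imaginaryPeriodRat = minusPeriod f := by
      rw [if_neg hodd] at hϖ; exact hϖ
    rcases hB with ⟨hord, -⟩ | ⟨hs, hBeq⟩ | ⟨hm, hns, hBeq⟩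
    · exact absurd ((isOrdinaryAt_iff V p).mp hord).1
        (fun hgood => WeierstrassCurve.HasMultiplicativeReduction.not_hasGoodReduction (R := ℤ_[p]) hV hgood)
    · obtain ⟨h1, -⟩ := hf.cuspCoeff_eq_one_and_sq_of_split hs
      have h := (hrec V C hV hC' f hf 1 (by exact_mod_cast h1) ϖ hϖ').2
      rw [Int.cast_one] at h
      rw [hBeq, if_neg hodd]; exact h
    · obtain ⟨h1, -⟩ := hf.cuspCoeff_eq_neg_one_and_dvd_of_nonsplit hm hns
      have h := (hrec V C hV hC' f hf (-1) (by exact_mod_cast h1) ϖ hϖ').2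
      rw [Int.cast_neg, Int.cast_one] at h
      rw [hBeq, if_neg hodd]; exact h
  obtain ⟨θ, hθ2⟩ := hθ
  have hθnr : θ ∉ Set.range (algebraMap ℚ K) := not_mem_range_algebraMap_of_sq_eq_pStar hθ2
  haveI : (V.quadraticTwist ((-1 : ℚ) ^ (p / 2) * p)).IsElliptic := V.isElliptic_quadraticTwist hpS
  let D' : W.SelmerDualData κ γ :=
    ChiEigenSelmerInDualData.toSelmerDualData V K hK2 hθnr hθ2 p κ hC (galRange (K := ℚ) F)
      (isOpen_galRange F) (coprime_index_galRange_cyclotomic p F) hp2 hγK D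
  obtain ⟨-, g₀, hchar, ⟨u, hι⟩, -, -, -⟩ := charIdeal_eq_span_of_katoHalf_of_norm_coeff_of_budget hK
    hp2 hbud V C hC hsurjV hκ hγ hcv hf D' B hB ϖ hϖ hn
  have hg' : g ∈ D'.charIdeal := hg
  rw [hchar] at hg'
  obtain ⟨h, rfl⟩ := Ideal.mem_span_singleton'.mp hg'
  have hCu : iwasawaToPowerSeries p (PowerSeries.C (u : ℤ_[p])) =
      PowerSeries.C (((u : ℤ_[p]) : ℚ_[p])) := by
    rw [← mul_one (PowerSeries.C (u : ℤ_[p])), iwasawaToPowerSeries_C_mul', map_one, mul_one]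
  refine ⟨PowerSeries.C (u : ℤ_[p]) * h, ?_⟩
  simp only [map_mul, hι, hCu]
  ring

/-- **Parity-free form, EVERY odd `p`**: on X4(M) ∧ surj(p), the record of the parity of
`(p−1)/2` at index `b` + the budget ⟹ p10's node for every twist model. -/
theorem ClassX4M.forall_quadraticBranchLowerDivisibilityAt_of_katoHalf_of_firstUnitIndex_of_budget'
    (hK : Wuthrich2014.kato_halfEigenCharIdeal_dvd_cyclotomicPrime_of_surjective)
    (hX : ClassX4M W p) (hsurj : Surj W p) {b : ℕ}
    (hrec : (p % 4 = 1 → MultFirstUnitIndexAt W p b) ∧ (p % 4 = 3 → MultOddFirstUnitIndexAt W p b))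
    (hbud : BudgetLeLambdaAt p W b)
    (V : WeierstrassCurve ℚ) [V.IsElliptic] [V.IsGloballyMinimal]
    (hVW : ∃ C : VariableChange ℚ, C • V.quadraticTwist ((-1) ^ (p / 2) * p : ℚ) = W) :
    QuadraticBranchLowerDivisibilityAt V p := by
  obtain ⟨k, hk⟩ : Odd p := hp.out.odd_of_ne_two hX.p_ne_two
  rcases (show p % 4 = 1 ∨ p % 4 = 3 by omega) with hp4 | hp4
  · exact hX.forall_quadraticBranchLowerDivisibilityAt_of_katoHalf_of_firstUnitIndex_of_budget hK hsurj
      hp4 (hrec.1 hp4) hbud V hVW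
  · exact hX.forall_quadraticBranchLowerDivisibilityAt_of_katoHalf_of_firstUnitIndex_of_budget_odd hK
      hsurj hp4 (hrec.2 hp4) hbud V hVW

end IntegralNode

end Summit.BirchSwinnertonDyer.Rank1Residual.AdditivePotMult

end
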